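import Literature.Analysis.FluidPDE.LocalBiotSavartLog
import Literature.Analysis.FluidPDE.BiotSavartCurlGradient

/-! # The local Biot–Savart law at the centre of the cutoff — crux stmt-NavierStokesRegularity-11291 (`CoreLogGas.BlowupIsLocallyDriven`), line registered, stub stub_centreGrad

Registered stub `stub_centreGrad` (`--supports stmt-NavierStokesRegularity-11291`) of the line
`registered` of the crux `CoreLogGas.BlowupIsLocallyDriven`: for a smooth divergence-free
`v ∈ L²(ℝ³)`, a centre `x` and a radius `r > 0`, with the in-tree cutoff `ψ = ballCutoff x r`
(`= 1` on `B̄(x, 2r)`, supported in `B(x, 3r)`, values in `[0, 1]`), the Biot–Savart velocity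
`K₃ ∗ (ψω)` of the localised vorticity `ψω`, `ω = curl v`, is differentiable at `x` and
`‖∇v(x) − ∇(K₃ ∗ (ψω))(x)‖ ≤ C (r^{-5/2} ‖v‖_{L²} + r⁻³ ∫_{B(x,3r)} ‖ω‖)` with an absolute `C`.

Proof (Tao, arXiv:1108.1165, §10, proof of Thm. 10.1, p. 32: the local Biot–Savart law, at the
centre of the cutoff). The tree's `LocalBiotSavart.lean` gives on `B(x, r)`
`∂ₖvₘ = −(∂ₖ∂_{m+1}N[ψω_{m+2}] − ∂ₖ∂_{m+2}N[ψω_{m+1}]) + ∂ₖΛ[ψvₘ]` (`fderiv_coord_eq`) with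
`N = newtonNearPotential (r/2) r` the truncated Newtonian potential (kernel `Γ₀ = Γ − Γ∞`,
`Γ(z) = −(4π|z|)⁻¹`, `Γ∞ = newtonFar (r/2) r` smooth, `= Γ` off `B(0, r)`, `= 0` on `B(0, r/2)`)
and `Λ` the smoothing operator of scale `r`, `Σₖₘ |∂ₖΛ[ψvₘ](x)| ≤ 3 C₂ r^{-5/2} ‖v‖_{L²}`
(`sum_abs_fderiv_smoothing_le_sqrt`). On the other hand, componentwise
`(K₃ ∗ h)ₘ = −(T_{m+1}[h_{m+2}] − T_{m+2}[h_{m+1}])` with the gradient potentials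
`T_a[g] = ∫ ∂_aΓ(· − z) g(z) dz` (`biotSavart_apply`), and `T_a = T⁰_a + T∞_a` at radii `(r/2, r)`
with `T⁰_a[g] = ∂ₐN[g]` for `g ∈ C¹_c` (`fderiv_newtonNearPotential_eq_newtonNearGradPotential`).
Hence the Hessian entries of `N[ψω_b]` cancel in `∂ₖvₘ(x) − ∂ₖ(K₃ ∗ (ψω))ₘ(x)`, which equals
`∂ₖΛ[ψvₘ](x) + (∂ₖT∞_{m+1}[ψω_{m+2}](x) − ∂ₖT∞_{m+2}[ψω_{m+1}](x))`, and
`∂ₖT∞_a[ψω_b](x) = ∫ ∂ₖ∂ₐΓ∞(x − y) ψω_b(y) dy` is at most `K r⁻³ ∫_{B(x,3r)} ‖ω‖` by the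
scale-free Hessian bound `‖D²Γ∞^{r/2,r}‖ ≤ K r⁻³` (`norm_fderiv2_newtonFar_scale_le`). Summing the
nine entries (`opNorm_le_sum_abs_coord`) gives the claim with `C = 3 C₂ + 18 K`.
(Physical space is `EuclideanSpace ℝ (Fin 3)`, the basis vectors `𝐞ₖ = EuclideanSpace.single k 1`.)
-/

noncomputable section

open Set MeasureTheory Filter Topology Function Metric

namespace Summit.NavierStokesRegularity.NavierStokesRegularity.Theorems.BlowupIsLocallyDriven.Registered

open Literature.Analysis.FluidPDE
open scoped ContDiff

-- The summit namespace `Summit.NavierStokesRegularity.NavierStokesRegularity.…` is fixed by the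
-- route (problem and summit share the name), so the duplicated component is intended.
set_option linter.dupNamespace false

/-! ### The near/far splitting of the gradient potential at general radii -/

/-- **`T_a f = T⁰_a f + T∞_a f` at radii `(r₀, r₁)`** for a continuous compactly supported scalar
density: `∫ ∂_aΓ(y − z) f(z) dz = ∫ ∂_aΓ₀(y − z) f(z) dz + ∫ ∂_aΓ∞(y − z) f(z) dz`
(`∂_aΓ = ∂_aΓ₀ + ∂_aΓ∞` off the null diagonal; the tree's `newtonGradPotential_eq_near_add_far`
is the case `(r₀, r₁) = (1, 2)`). [folklore] -/
theorem centreGrad_newtonGradPotential_eq_near_add_far {r₀ r₁ : ℝ} (h₀ : 0 < r₀) (h₁ : r₀ < r₁)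
    (a : EuclideanSpace ℝ (Fin 3)) {f : EuclideanSpace ℝ (Fin 3) → ℝ} (hf : Continuous f)
    (hfc : HasCompactSupport f) (y : EuclideanSpace ℝ (Fin 3)) :
    newtonGradPotential a f y =
      newtonNearGradPotential r₀ r₁ a f y + newtonFarGradPotential r₀ r₁ a f y := by
  -- adapted from `newtonGradPotential_eq_near_add_far` (NewtonGradientPotential.lean)
  have hfar : Integrable fun z => newtonFarGrad r₀ r₁ a (y - z) • f z :=
    integrable_bilin_kernel_sub_of_hasCompactSupport
      (contDiff_newtonFarGrad h₀ h₁ a (n := 0)).continuous (ContinuousLinearMap.lsmul ℝ ℝ) hf hfc y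
  rw [newtonGradPotential, newtonNearGradPotential, newtonFarGradPotential,
    ← integral_add (integrable_newtonNearGradPotential h₀ h₁ a hf y) hfar]
  refine integral_congr_ae ?_
  filter_upwards [Measure.ae_ne volume y] with z hz
  have hz' : y - z ≠ 0 := sub_ne_zero.2 (Ne.symm hz)
  rw [newtonNearGrad, newtonFarGrad, fderiv_newtonNear_eq_sub h₀ h₁ hz',
    sub_apply, ← add_smul, sub_add_cancel]

/-! ### The components of the Biot–Savart velocity through scalar gradient potentials -/

/-- **`(K₃ ∗ h)ₘ = −(T_{m+1}[h_{m+2}] − T_{m+2}[h_{m+1}])`** for a continuous compactly supported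
density `h : ℝ³ → ℝ³`, with the scalar gradient potentials `T_a[g](y) = ∫ ∂_aΓ(y − z) g(z) dz`
of the components of `h` (the tree's `biotSavart_apply`, components taken inside the Bochner
integral). [folklore] -/
theorem centreGrad_biotSavart_apply_coord
    {h : EuclideanSpace ℝ (Fin 3) → EuclideanSpace ℝ (Fin 3)} (hc : Continuous h)
    (hs : HasCompactSupport h) (y : EuclideanSpace ℝ (Fin 3)) (m : Fin 3) :
    biotSavart h y m =
      -(newtonGradPotential (EuclideanSpace.single (succIdx m) (1 : ℝ))
            (fun z => h z (succIdx₂ m)) y -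
          newtonGradPotential (EuclideanSpace.single (succIdx₂ m) (1 : ℝ))
            (fun z => h z (succIdx m)) y) := by
  have key : ∀ j k : Fin 3, newtonGradPotential (EuclideanSpace.single j (1 : ℝ)) h y k =
      newtonGradPotential (EuclideanSpace.single j (1 : ℝ)) (fun z => h z k) y := by
    intro j k
    rw [newtonGradPotential, newtonGradPotential,
      integral_apply_fin_three (integrable_fderiv_newtonKernel_smul hc hs y _) k]
    simp only [PiLp.smul_apply, smul_eq_mul]
  rw [biotSavart_apply hc hs y m]
  fin_cases m <;> simp [succIdx, succIdx₂, key]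

/-! ### The localised vorticity in `L¹` -/

/-- `∫ |ψ ω_b| ≤ ∫_{B(x,3r)} ‖ω‖` (`|ψ| ≤ 1`, `ψ = 0` off `B(x, 3r)`, `|ω_b| ≤ ‖ω‖`). [folklore] -/
theorem centreGrad_integral_norm_locVort_le
    {v : EuclideanSpace ℝ (Fin 3) → EuclideanSpace ℝ (Fin 3)} (hv : ContDiff ℝ 1 v) {r : ℝ}
    (hr : 0 < r) (x : EuclideanSpace ℝ (Fin 3)) (b : Fin 3) :
    ∫ y, ‖locVort v x r b y‖ ≤ ∫ y in ball x (3 * r), ‖curl v y‖ := by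
  have hω : Continuous (curl v) := continuous_curl hv
  have hωb : Continuous fun y => curl v y b :=
    (EuclideanSpace.proj b : EuclideanSpace ℝ (Fin 3) →L[ℝ] ℝ).continuous.comp hω
  have hfi : IntegrableOn (fun y => ‖curl v y‖) (ball x (3 * r)) :=
    (hω.norm.continuousOn.integrableOn_compact (isCompact_closedBall x (3 * r))).mono_set
      ball_subset_closedBall
  rw [← setIntegral_eq_integral_of_forall_compl_eq_zero (s := ball x (3 * r)) (fun y hy => by
    rw [mem_ball, dist_eq_norm, not_lt] at hy
    rw [locVort, ballCutoff_eq_zero hr hy, zero_mul, norm_zero])]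
  refine setIntegral_mono_on ?_ hfi measurableSet_ball fun y _ => ?_
  · exact ((((contDiff_ballCutoff x r (n := 0)).continuous.mul hωb).norm).continuousOn
      |>.integrableOn_compact (isCompact_closedBall x (3 * r))).mono_set ball_subset_closedBall
  · rw [locVort, norm_mul, Real.norm_eq_abs]
    calc |ballCutoff x r y| * ‖curl v y b‖ ≤ 1 * ‖curl v y‖ :=
          mul_le_mul (abs_ballCutoff_le_one x r y) (PiLp.norm_apply_le (curl v y) b)
            (norm_nonneg _) zero_le_one
      _ = ‖curl v y‖ := one_mul _

/-! ### The scale-free bound for the far Hessian kernel -/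

section FarHess

-- nested operator types `ℝ³ →L[ℝ] ℝ³ →L[ℝ] ℝ` (second derivatives), as in `NewtonPotential.lean`
set_option maxSynthPendingDepth 3

/-- **`|∂_b∂_aΓ∞^{r/2,r}(z)| ≤ K r⁻³ ‖a‖ ‖b‖`** with an absolute constant `K`: the far kernel at
radii `(r/2, r)` is the rescaling `r⁻¹ Γ∞^{1/2,1}(r⁻¹ ·)` of the unit one, whose Hessian is
bounded (`exists_bound_newtonFar_derivs`, `norm_fderiv2_newtonFar_scale_le`). [folklore] -/
theorem centreGrad_exists_newtonFarHess_bound :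
    ∃ K : ℝ, 0 ≤ K ∧ ∀ (r : ℝ), 0 < r → ∀ (a b z : EuclideanSpace ℝ (Fin 3)),
      |newtonFarHess (r / 2) r a b z| ≤ K * r⁻¹ ^ 3 * ‖a‖ * ‖b‖ := by
  obtain ⟨-, -, ⟨M, hM⟩, -⟩ :=
    exists_bound_newtonFar_derivs (r₀ := 1 / 2) (r₁ := 1) one_half_pos one_half_lt_one
  have hM0 : 0 ≤ M := (norm_nonneg _).trans (hM 0)
  refine ⟨M, hM0, fun r hr a b z => ?_⟩
  have hscale : newtonFar (r / 2) r = newtonFar (r * (1 / 2)) (r * 1) := by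
    rw [mul_one, mul_one_div]
  have hD : ‖fderiv ℝ (fderiv ℝ (newtonFar (r / 2) r)) z‖ ≤ r⁻¹ ^ 3 * M := by
    rw [hscale]; exact norm_fderiv2_newtonFar_scale_le hr hM z
  rw [newtonFarHess]
  calc |fderiv ℝ (fderiv ℝ (newtonFar (r / 2) r)) z b a|
      ≤ ‖fderiv ℝ (fderiv ℝ (newtonFar (r / 2) r)) z b‖ * ‖a‖ := by
        rw [← Real.norm_eq_abs]; exact ContinuousLinearMap.le_opNorm _ _
    _ ≤ ‖fderiv ℝ (fderiv ℝ (newtonFar (r / 2) r)) z‖ * ‖b‖ * ‖a‖ := by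
        gcongr; exact ContinuousLinearMap.le_opNorm _ _
    _ ≤ r⁻¹ ^ 3 * M * ‖b‖ * ‖a‖ := by gcongr
    _ = M * r⁻¹ ^ 3 * ‖a‖ * ‖b‖ := by ring

end FarHess

section Centre

variable {v : EuclideanSpace ℝ (Fin 3) → EuclideanSpace ℝ (Fin 3)} {r : ℝ}

/-! ### The derivative of the far gradient potential of the localised vorticity -/

/-- **`|∂ₖ T∞_a[ψ ω_b](x)| ≤ K r⁻³ ∫_{B(x,3r)} ‖ω‖`**: the derivative of the far gradient
potential is the integral of the bounded kernel `∂ₖ∂_aΓ∞^{r/2,r}(x − y)` against `ψ ω_b`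
(`fderiv_newtonFarGradPotential_apply`). [folklore] -/
theorem centreGrad_abs_fderiv_newtonFarGradPotential_le {K : ℝ}
    (hK : ∀ (r : ℝ), 0 < r → ∀ (a b z : EuclideanSpace ℝ (Fin 3)),
      |newtonFarHess (r / 2) r a b z| ≤ K * r⁻¹ ^ 3 * ‖a‖ * ‖b‖)
    (hv : ContDiff ℝ ∞ v) (hr : 0 < r) (x : EuclideanSpace ℝ (Fin 3)) (a k b : Fin 3) :
    |fderiv ℝ (newtonFarGradPotential (r / 2) r (EuclideanSpace.single a (1 : ℝ))
        (locVort v x r b)) x (EuclideanSpace.single k (1 : ℝ))| ≤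
      K * r⁻¹ ^ 3 * ∫ y in ball x (3 * r), ‖curl v y‖ := by
  have h₀ : 0 < r / 2 := half_pos hr
  have h₁ : r / 2 < r := half_lt_self hr
  have hWc : Continuous (locVort v x r b) := (contDiff_locVort hv x r b (n := 0)).continuous
  have hWs : HasCompactSupport (locVort v x r b) := hasCompactSupport_locVort hr v b
  rw [fderiv_newtonFarGradPotential_apply h₀ h₁ _ hWc hWs x _]
  have hw : ∀ y, |newtonFarHess (r / 2) r (EuclideanSpace.single a (1 : ℝ))
      (EuclideanSpace.single k (1 : ℝ)) (x - y)| ≤ K * r⁻¹ ^ 3 := fun y => by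
    have h := hK r hr (EuclideanSpace.single a (1 : ℝ)) (EuclideanSpace.single k (1 : ℝ)) (x - y)
    rw [EuclideanSpace.single, EuclideanSpace.single, PiLp.norm_single, PiLp.norm_single, norm_one,
      mul_one, mul_one] at h
    exact h
  have hK0 : 0 ≤ K * r⁻¹ ^ 3 := (abs_nonneg _).trans (hw x)
  calc |∫ y, newtonFarHess (r / 2) r (EuclideanSpace.single a (1 : ℝ))
          (EuclideanSpace.single k (1 : ℝ)) (x - y) • locVort v x r b y|
      ≤ K * r⁻¹ ^ 3 * ∫ y, ‖locVort v x r b y‖ := by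
        rw [← Real.norm_eq_abs]; exact norm_integral_smul_le_of_abs_le hw hWc hWs
    _ ≤ K * r⁻¹ ^ 3 * ∫ y in ball x (3 * r), ‖curl v y‖ := by
        gcongr
        exact centreGrad_integral_norm_locVort_le (hv.of_le (by norm_cast)) hr x b

/-! ### The Biot–Savart velocity of the localised vorticity through the local potentials -/

/-- **The components of `K₃ ∗ (ψω)` through the local potentials**:
`(K₃ ∗ (ψω))ₘ = −((∂_{m+1}N[W_{m+2}] + T∞_{m+1}[W_{m+2}]) − (∂_{m+2}N[W_{m+1}] + T∞_{m+2}[W_{m+1}]))`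
everywhere, `W_b = ψ ω_b = locVort v x r b`, `N = newtonNearPotential (r/2) r` the truncated
Newtonian potential and `T∞_a = newtonFarGradPotential (r/2) r 𝐞ₐ` the far gradient potential
(`Γ = Γ₀ + Γ∞`, and `∂ₐN[W] = T⁰ₐ[W]` by `fderiv_newtonNearPotential_eq_newtonNearGradPotential`).
[folklore] -/
theorem centreGrad_biotSavart_locVort_apply (hv : ContDiff ℝ ∞ v) (hr : 0 < r)
    (x y : EuclideanSpace ℝ (Fin 3)) (m : Fin 3) :
    biotSavart (fun z => ballCutoff x r z • curl v z) y m =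
      -((fderiv ℝ (newtonNearPotential (r / 2) r (locVort v x r (succIdx₂ m))) y
            (EuclideanSpace.single (succIdx m) (1 : ℝ)) +
          newtonFarGradPotential (r / 2) r (EuclideanSpace.single (succIdx m) (1 : ℝ))
            (locVort v x r (succIdx₂ m)) y) -
        (fderiv ℝ (newtonNearPotential (r / 2) r (locVort v x r (succIdx m))) y
            (EuclideanSpace.single (succIdx₂ m) (1 : ℝ)) +
          newtonFarGradPotential (r / 2) r (EuclideanSpace.single (succIdx₂ m) (1 : ℝ))
            (locVort v x r (succIdx m)) y)) := by
  have h₀ : 0 < r / 2 := half_pos hr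
  have h₁ : r / 2 < r := half_lt_self hr
  have hv1 : ContDiff ℝ 1 v := hv.of_le (by norm_cast)
  have hc : Continuous (fun z => ballCutoff x r z • curl v z) :=
    (contDiff_ballCutoff x r (n := 0)).continuous.smul (continuous_curl hv1)
  have hs : HasCompactSupport (fun z => ballCutoff x r z • curl v z) :=
    (hasCompactSupport_ballCutoff hr).smul_right
  have hW1 : ∀ b, ContDiff ℝ 1 (locVort v x r b) := fun b => contDiff_locVort hv x r b
  have hWc : ∀ b, Continuous (locVort v x r b) := fun b => (hW1 b).continuous
  have hWs : ∀ b, HasCompactSupport (locVort v x r b) := fun b => hasCompactSupport_locVort hr v b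
  have hcomp : ∀ b, (fun z => (ballCutoff x r z • curl v z) b) = locVort v x r b := fun b => by
    funext z
    rw [PiLp.smul_apply, smul_eq_mul, locVort]
  rw [centreGrad_biotSavart_apply_coord hc hs y m]
  simp only [hcomp]
  rw [centreGrad_newtonGradPotential_eq_near_add_far h₀ h₁ _ (hWc _) (hWs _) y,
    centreGrad_newtonGradPotential_eq_near_add_far h₀ h₁ _ (hWc _) (hWs _) y,
    ← fderiv_newtonNearPotential_eq_newtonNearGradPotential h₀ h₁ (hW1 _) (hWs _) y,
    ← fderiv_newtonNearPotential_eq_newtonNearGradPotential h₀ h₁ (hW1 _) (hWs _) y]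

/-- The near pieces `y ↦ ∂ₐN[W_b](y)` are differentiable (`N[W_b] ∈ C²`). [folklore] -/
theorem centreGrad_differentiable_fderiv_newtonNearPotential (hv : ContDiff ℝ ∞ v) (hr : 0 < r)
    (x : EuclideanSpace ℝ (Fin 3)) (a b : Fin 3) :
    Differentiable ℝ fun y => fderiv ℝ (newtonNearPotential (r / 2) r (locVort v x r b)) y
      (EuclideanSpace.single a (1 : ℝ)) := by
  have hN : ContDiff ℝ 2 (newtonNearPotential (r / 2) r (locVort v x r b)) :=
    contDiff_newtonNearPotential (half_pos hr).le (half_lt_self hr) 2 (contDiff_locVort hv x r b)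
  exact ((hN.fderiv_right (m := 1) le_rfl).clm_apply contDiff_const).differentiable one_ne_zero

/-- The far pieces `T∞ₐ[W_b]` are differentiable (smooth kernel against a continuous compactly
supported density). [folklore] -/
theorem centreGrad_differentiable_newtonFarGradPotential (hv : ContDiff ℝ ∞ v) (hr : 0 < r)
    (x : EuclideanSpace ℝ (Fin 3)) (a b : Fin 3) :
    Differentiable ℝ (newtonFarGradPotential (r / 2) r (EuclideanSpace.single a (1 : ℝ))
      (locVort v x r b)) := fun y =>
  (hasFDerivAt_newtonFarGradPotential (half_pos hr) (half_lt_self hr) _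
    (contDiff_locVort hv x r b (n := 0)).continuous (hasCompactSupport_locVort hr v b)
    y).differentiableAt

/-- **The derivative of `(K₃ ∗ (ψω))ₘ`** (term by term from `centreGrad_biotSavart_locVort_apply`).
[folklore] -/
theorem centreGrad_hasFDerivAt_biotSavart_coord (hv : ContDiff ℝ ∞ v) (hr : 0 < r)
    (x y : EuclideanSpace ℝ (Fin 3)) (m : Fin 3) :
    HasFDerivAt (fun y => biotSavart (fun z => ballCutoff x r z • curl v z) y m)
      (-((fderiv ℝ (fun y => fderiv ℝ (newtonNearPotential (r / 2) r
              (locVort v x r (succIdx₂ m))) y (EuclideanSpace.single (succIdx m) (1 : ℝ))) y +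
            fderiv ℝ (newtonFarGradPotential (r / 2) r (EuclideanSpace.single (succIdx m) (1 : ℝ))
              (locVort v x r (succIdx₂ m))) y) -
          (fderiv ℝ (fun y => fderiv ℝ (newtonNearPotential (r / 2) r
              (locVort v x r (succIdx m))) y (EuclideanSpace.single (succIdx₂ m) (1 : ℝ))) y +
            fderiv ℝ (newtonFarGradPotential (r / 2) r (EuclideanSpace.single (succIdx₂ m) (1 : ℝ))
              (locVort v x r (succIdx m))) y))) y := by
  have hfun : (fun y => biotSavart (fun z => ballCutoff x r z • curl v z) y m) = fun y =>
      -((fderiv ℝ (newtonNearPotential (r / 2) r (locVort v x r (succIdx₂ m))) y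
            (EuclideanSpace.single (succIdx m) (1 : ℝ)) +
          newtonFarGradPotential (r / 2) r (EuclideanSpace.single (succIdx m) (1 : ℝ))
            (locVort v x r (succIdx₂ m)) y) -
        (fderiv ℝ (newtonNearPotential (r / 2) r (locVort v x r (succIdx m))) y
            (EuclideanSpace.single (succIdx₂ m) (1 : ℝ)) +
          newtonFarGradPotential (r / 2) r (EuclideanSpace.single (succIdx₂ m) (1 : ℝ))
            (locVort v x r (succIdx m)) y)) :=
    funext fun y => centreGrad_biotSavart_locVort_apply hv hr x y m
  rw [hfun]
  have hD := fun a b => centreGrad_differentiable_fderiv_newtonNearPotential hv hr x a b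
  have hQ := fun a b => centreGrad_differentiable_newtonFarGradPotential hv hr x a b
  exact ((((hD _ _ y).hasFDerivAt).add ((hQ _ _ y).hasFDerivAt)).sub
    (((hD _ _ y).hasFDerivAt).add ((hQ _ _ y).hasFDerivAt))).neg

/-- **The Biot–Savart velocity of the localised vorticity is differentiable.** [folklore] -/
theorem centreGrad_differentiableAt_biotSavart (hv : ContDiff ℝ ∞ v) (hr : 0 < r)
    (x y : EuclideanSpace ℝ (Fin 3)) :
    DifferentiableAt ℝ (biotSavart (fun z => ballCutoff x r z • curl v z)) y :=
  differentiableAt_euclidean.2 fun m =>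
    (centreGrad_hasFDerivAt_biotSavart_coord hv hr x y m).differentiableAt

/-- **The entries of `∇v(x) − ∇(K₃ ∗ (ψω))(x)` at the centre**: by the local Biot–Savart law
(`fderiv_coord_eq`: `∂ₖvₘ(x) = −(H k (m+1) (m+2) − H k (m+2) (m+1))(x) + ∂ₖΛ[Φₘ](x)`) the
Hessian entries of the truncated potentials cancel, leaving the smoothing term and the far
gradient potentials:
`∂ₖvₘ(x) − ∂ₖ(K₃ ∗ (ψω))ₘ(x) = ∂ₖΛ[Φₘ](x) + (∂ₖT∞_{m+1}[W_{m+2}](x) − ∂ₖT∞_{m+2}[W_{m+1}](x))`.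
[cite: Tao2011, §10, proof of Thm. 10.1 (p. 32)] -/
theorem centreGrad_fderiv_sub_coord (hv : ContDiff ℝ ∞ v) (hdiv : VectorCalculus.IsDivFree v)
    (hr : 0 < r) (x : EuclideanSpace ℝ (Fin 3)) (k m : Fin 3) :
    fderiv ℝ v x (EuclideanSpace.single k (1 : ℝ)) m -
        fderiv ℝ (biotSavart (fun z => ballCutoff x r z • curl v z)) x
          (EuclideanSpace.single k (1 : ℝ)) m =
      fderiv ℝ (newtonFarSmoothing (r / 2) r (locVel v x r m)) x (EuclideanSpace.single k (1 : ℝ)) +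
        (fderiv ℝ (newtonFarGradPotential (r / 2) r (EuclideanSpace.single (succIdx m) (1 : ℝ))
            (locVort v x r (succIdx₂ m))) x (EuclideanSpace.single k (1 : ℝ)) -
          fderiv ℝ (newtonFarGradPotential (r / 2) r (EuclideanSpace.single (succIdx₂ m) (1 : ℝ))
            (locVort v x r (succIdx m))) x (EuclideanSpace.single k (1 : ℝ))) := by
  rw [fderiv_coord_eq hv hdiv hr m k (mem_ball_self hr),
    ← fderiv_apply_coord (centreGrad_differentiableAt_biotSavart hv hr x x) _ m,
    (centreGrad_hasFDerivAt_biotSavart_coord hv hr x x m).fderiv]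
  simp only [neg_apply, sub_apply, add_apply, hessPot]
  ring

/-- **The entrywise bound**:
`|∂ₖvₘ(x) − ∂ₖ(K₃ ∗ (ψω))ₘ(x)| ≤ |∂ₖΛ[Φₘ](x)| + 2 K r⁻³ ∫_{B(x,3r)} ‖ω‖`. [folklore] -/
theorem centreGrad_abs_fderiv_sub_coord_le {K : ℝ}
    (hK : ∀ (r : ℝ), 0 < r → ∀ (a b z : EuclideanSpace ℝ (Fin 3)),
      |newtonFarHess (r / 2) r a b z| ≤ K * r⁻¹ ^ 3 * ‖a‖ * ‖b‖)
    (hv : ContDiff ℝ ∞ v) (hdiv : VectorCalculus.IsDivFree v) (hr : 0 < r)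
    (x : EuclideanSpace ℝ (Fin 3)) (k m : Fin 3) :
    |fderiv ℝ v x (EuclideanSpace.single k (1 : ℝ)) m -
        fderiv ℝ (biotSavart (fun z => ballCutoff x r z • curl v z)) x
          (EuclideanSpace.single k (1 : ℝ)) m| ≤
      |fderiv ℝ (newtonFarSmoothing (r / 2) r (locVel v x r m)) x (EuclideanSpace.single k (1 : ℝ))| +
        2 * (K * r⁻¹ ^ 3 * ∫ y in ball x (3 * r), ‖curl v y‖) := by
  rw [centreGrad_fderiv_sub_coord hv hdiv hr x k m]
  have h1 := centreGrad_abs_fderiv_newtonFarGradPotential_le hK hv hr x (succIdx m) k (succIdx₂ m)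
  have h2 := centreGrad_abs_fderiv_newtonFarGradPotential_le hK hv hr x (succIdx₂ m) k (succIdx m)
  refine (abs_add_le _ _).trans ?_
  gcongr
  refine (abs_sub _ _).trans ?_
  linarith

end Centre

/-! ### The stub -/

/-- **stub F2 — `stub_centreGrad` (Tao's local Biot–Savart law at the centre of the cutoff).**
For a smooth divergence-free `v ∈ L²`, a centre `x` and a radius `r > 0`, with
`ψ = ballCutoff x r` (`= 1` on `B̄(x,2r)`, supported in `B(x,3r)`), the Biot–Savart velocity of
the localised vorticity `ψ • curl v` is differentiable at `x` and
`‖∇v(x) − ∇(biotSavart (ψ • curl v))(x)‖ ≤ C (r^{-5/2} ‖v‖_{L²} + r⁻³ ∫_{B(x,3r)} ‖curl v‖)` with an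
absolute constant `C`. Proof: componentwise `K₃ ∗ (ψω) = −"curl"` of the gradient potentials
`T_a[ψω_b] = T⁰_a[ψω_b] + T∞_a[ψω_b]` (`Γ = Γ₀ + Γ∞` at radii `(r/2, r)`); the near parts are the
derivatives `∂ₐN[ψω_b]` of the truncated Newtonian potentials of the tree's local Biot–Savart law
`∂ₖvₘ = −(∂ₖ∂_{m+1}N[ψω_{m+2}] − ∂ₖ∂_{m+2}N[ψω_{m+1}]) + ∂ₖΛ[ψvₘ]` on `B(x, r)` (`fderiv_coord_eq`),
so they cancel in the difference, which is `∂ₖΛ[ψvₘ](x)` (bounded by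
`3 C₂ r^{-5/2} ‖v‖_{L²}`, `sum_abs_fderiv_smoothing_le_sqrt`) plus far terms
`∫ ∂ₖ∂ₐΓ∞^{r/2,r}(x − y) ψω_b(y) dy`, each at most `K r⁻³ ∫_{B(x,3r)} ‖ω‖` by the scale-free
Hessian bound of `Γ∞`. [cite: Tao2011, §10, proof of Thm. 10.1 (p. 32)] -/
theorem stub_centreGrad :
    ∃ C : ℝ, 0 ≤ C ∧ ∀ (v : EuclideanSpace ℝ (Fin 3) → EuclideanSpace ℝ (Fin 3)),
      ContDiff ℝ ∞ v → Literature.Analysis.FluidPDE.VectorCalculus.IsDivFree v →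
      MeasureTheory.Integrable (fun y => ‖v y‖ ^ 2) MeasureTheory.volume →
      ∀ (x : EuclideanSpace ℝ (Fin 3)) (r : ℝ), 0 < r →
        DifferentiableAt ℝ (Literature.Analysis.FluidPDE.biotSavart
          (fun y => Literature.Analysis.FluidPDE.ballCutoff x r y • Literature.Analysis.FluidPDE.curl v y)) x ∧
        ‖fderiv ℝ v x - fderiv ℝ (Literature.Analysis.FluidPDE.biotSavart
          (fun y => Literature.Analysis.FluidPDE.ballCutoff x r y • Literature.Analysis.FluidPDE.curl v y)) x‖ ≤
          C * (Real.sqrt (r⁻¹ ^ 5) * Real.sqrt (∫ y, ‖v y‖ ^ 2) +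
            (r ^ 3)⁻¹ * ∫ y in Metric.ball x (3 * r), ‖Literature.Analysis.FluidPDE.curl v y‖) := by
  obtain ⟨K, hK0, hK⟩ := centreGrad_exists_newtonFarHess_bound
  refine ⟨3 * lamGradL2 + 18 * K,
    add_nonneg (mul_nonneg (by norm_num) lamGradL2_nonneg) (mul_nonneg (by norm_num) hK0),
    fun v hv hdiv hL2 x r hr => ⟨centreGrad_differentiableAt_biotSavart hv hr x x, ?_⟩⟩
  have hIB0 : 0 ≤ ∫ y in ball x (3 * r), ‖curl v y‖ := integral_nonneg fun _ => norm_nonneg _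
  have hE0 : 0 ≤ Real.sqrt (∫ y, ‖v y‖ ^ 2) := Real.sqrt_nonneg _
  have hS0 : 0 ≤ Real.sqrt (r⁻¹ ^ 5) := Real.sqrt_nonneg _
  -- the entries of the difference
  have hentry : ∀ k m : Fin 3,
      |(fderiv ℝ v x - fderiv ℝ (biotSavart (fun z => ballCutoff x r z • curl v z)) x)
          (EuclideanSpace.single k (1 : ℝ)) m| ≤
        |fderiv ℝ (newtonFarSmoothing (r / 2) r (locVel v x r m)) x
            (EuclideanSpace.single k (1 : ℝ))| +
          2 * (K * r⁻¹ ^ 3 * ∫ y in ball x (3 * r), ‖curl v y‖) := by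
    intro k m
    rw [sub_apply, PiLp.sub_apply]
    exact centreGrad_abs_fderiv_sub_coord_le hK hv hdiv hr x k m
  calc ‖fderiv ℝ v x - fderiv ℝ (biotSavart (fun z => ballCutoff x r z • curl v z)) x‖
      ≤ ∑ k, ∑ m, |(fderiv ℝ v x - fderiv ℝ (biotSavart (fun z => ballCutoff x r z • curl v z)) x)
          (EuclideanSpace.single k (1 : ℝ)) m| := opNorm_le_sum_abs_coord _
    _ ≤ ∑ k, ∑ m : Fin 3, (|fderiv ℝ (newtonFarSmoothing (r / 2) r (locVel v x r m)) x
            (EuclideanSpace.single k (1 : ℝ))| +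
          2 * (K * r⁻¹ ^ 3 * ∫ y in ball x (3 * r), ‖curl v y‖)) := by
        gcongr with k _ m _
        exact hentry k m
    _ = (∑ k, ∑ m, |fderiv ℝ (newtonFarSmoothing (r / 2) r (locVel v x r m)) x
            (EuclideanSpace.single k (1 : ℝ))|) +
          9 * (2 * (K * r⁻¹ ^ 3 * ∫ y in ball x (3 * r), ‖curl v y‖)) := by
        simp only [Finset.sum_add_distrib, Finset.sum_const, Finset.card_univ, Fintype.card_fin,
          nsmul_eq_mul, Nat.cast_ofNat]
        ring
    _ ≤ 3 * (Real.sqrt (r⁻¹ ^ 5) * lamGradL2) * Real.sqrt (∫ y, ‖v y‖ ^ 2) +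
          9 * (2 * (K * r⁻¹ ^ 3 * ∫ y in ball x (3 * r), ‖curl v y‖)) := by
        gcongr
        exact sum_abs_fderiv_smoothing_le_sqrt hv hr hL2 x
    _ ≤ (3 * lamGradL2 + 18 * K) * (Real.sqrt (r⁻¹ ^ 5) * Real.sqrt (∫ y, ‖v y‖ ^ 2) +
          (r ^ 3)⁻¹ * ∫ y in ball x (3 * r), ‖curl v y‖) := by
        rw [inv_pow r 3]
        have hA : 0 ≤ Real.sqrt (r⁻¹ ^ 5) * Real.sqrt (∫ y, ‖v y‖ ^ 2) := mul_nonneg hS0 hE0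
        have hB : 0 ≤ (r ^ 3)⁻¹ * ∫ y in ball x (3 * r), ‖curl v y‖ :=
          mul_nonneg (by positivity) hIB0
        nlinarith [mul_nonneg lamGradL2_nonneg hB, mul_nonneg hK0 hA]

end Summit.NavierStokesRegularity.NavierStokesRegularity.Theorems.BlowupIsLocallyDriven.Registered

end
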